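import Summits.ResolutionOfSingularities.ResolutionOfSingularities.Theses.Dominance
import Summits.ResolutionOfSingularities.ResolutionOfSingularities.Theorems.RegularBlowupsDesingularization
import Summits.ResolutionOfSingularities.ResolutionOfSingularities.Theorems.DominanceOfTwoModelPatching
import Literature.AlgebraicGeometry.Morphisms.NagataCompactificationProofs
import Literature.AlgebraicGeometry.Resolution.BlowupsComposition
import Literature.AlgebraicGeometry.Resolution.BlowupsIntegral
import Literature.AlgebraicGeometry.Resolution.BlowupsProduct
import Literature.AlgebraicGeometry.Resolution.BlowupsProperProofs
import Literature.AlgebraicGeometry.Resolution.StrictNormalCrossingsAt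
import Literature.AlgebraicGeometry.Resolution.ComponentGluing
import HarnessLib

/-!
# DominanceDivisorCutPrincipalization — kernels 1–2 of the decomp-res node «DivisorCut» (lens-3 g6) BY NAME

Source HOME/decomp-res-lens-3/g6/DivisorCut.lean (sha256 9d24df0e1bf5399f, 619 lines; critic `lean check` rc 0 · 0
sorry ·
0 warnings · axioms standard), CRITIC-LEDGER row 39 (2026-08-30T06:05:20Z): CLEARED AS ATTACK NODE on
`Dominance.SandwichedResolveProper` (item 24574).  Pieces = route asides of `Theses/Dominance.lean` rev 8:
`LogResDiv` 29715 [UNDECIDED; flag «sufficient rung, necessity from S unknown»] · `MonomialPrincipalization` 29716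
[KNOWN-MOD-PORT, Goward] · `IdealsAreSumsOfDivisors` 29717 [COSTUME(textbook), SGA6 II 2.2.3–2.2.7.1] ·
`WeakPrincipalization` 29718 [glue, PROVED here] · `ProperReduction` 29719 · `EmbDesingDiv` 29720 · `EndGameDiv`
29721.

THE ONE TRANSLATION (ideal/sandwich language ↦ DIVISOR/log-resolution language, same dimension): a non-zero ideal
sheaf on a regular variety is a finite sup of effective Cartier ideals (SGA6); log resolution of the divisor
`D₁ + ⋯ + Dₙ` makes `I𝒪_{Y'}` MONOMIAL in an snc boundary; Goward principalizes monomial ideals in any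
characteristic;
Temkin 2008 Lemma 2.1.4 (`IsBlowup.exists_isBlowup_comp_supported`) packages the two stages as ONE blow-up.
Kernels in this file (0 sorry; the folklore surjectivity-over-`U` step is inlined, its stand-alone
form being the landed `EquisingularLiftNat.Sections.ND.exists_eq_of_isIso_morphismRestrict`):
`weakPrincipalization_of` (29717 → 29716 → 29715 → 29718) and
`sandwichedResolveProper_of_weakPrincipalization` (29718 → 24574), `sandwichedResolveProper_of`.
The split beneath `LogResDiv`, the Nagata step and the node's `closes` are in `Theorems/DominanceDivisorCut.lean`.
Why this is novel: transversality is never load-bearing — the divisor axis in dimension 4 sits on `EmbDesingDiv₄`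
(embedded desingularization of threefolds in regular fourfolds WITHOUT the snc clause), where it converges with the
contact-order / Hessian-rank locations of the other lenses. [Kollar2007 Thm. 3.35, (3.16); CossartJannsenSaito2020
Thm. 1.4]
-/

noncomputable section

namespace Summit.ResolutionOfSingularities.ResolutionOfSingularities.Theorems.DominanceDivisorCutPrincipalization

open CategoryTheory CategoryTheory.Limits AlgebraicGeometry TopologicalSpace
open Literature.AlgebraicGeometry.Resolution Literature.AlgebraicGeometry.Morphisms
open Summit.ResolutionOfSingularities.ResolutionOfSingularities.Theses
open Summit.ResolutionOfSingularities.ResolutionOfSingularities.Theorems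

/-! ## Two folklore lemmas -/

/-- On an integral scheme the generic point lies on no effective Cartier divisor (a local equation
is a non-zero-divisor, hence non-zero, of the domain `Γ(Y, U)`). [folklore] -/
theorem genericPoint_not_mem_support {Y : Scheme.{0}} [IsIntegral Y] {D : Y.IdealSheafData}
    (hD : IsEffectiveCartier D) : genericPoint Y ∉ (D.support : Set Y) := by
  obtain ⟨U, hξU, f, hf, hDU⟩ := hD (genericPoint Y)
  haveI : Nonempty (U : Y.Opens) := ⟨⟨_, hξU⟩⟩
  intro h
  have h' : genericPoint Y ∈ Y.zeroLocus (U := U.1) (D.ideal U) :=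
    (Scheme.IdealSheafData.mem_support_iff_of_mem hξU).mp h
  rw [hDU] at h'
  have hξ : genericPoint Y ∉ Y.basicOpen f :=
    (Y.mem_zeroLocus_iff _ _).mp h' f (Ideal.subset_span rfl)
  have hf0 : f ≠ 0 := nonZeroDivisors.ne_zero hf
  have hne : ((Y.basicOpen f : Y.Opens) : Set Y).Nonempty := by
    rw [Set.nonempty_iff_ne_empty]
    intro h0
    apply hf0
    rw [← basicOpen_eq_bot_iff]
    exact SetLike.coe_injective (h0.trans TopologicalSpace.Opens.coe_bot.symm)
  exact hξ (((genericPoint_spec Y).mem_open_set_iff (Y.basicOpen f).isOpen).mpr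
    (by simpa using hne))


/-! ## Kernel 1: the divisor cut of weak principalization -/

/-- **Weak principalization ⟸ (ideals are sums of divisors) ∧ (log resolution of divisors) ∧
(principalization of monomial ideals).**  PROVED. [cite: Goward2005, Thm. 2]
[cite: Temkin2008, Lemma 2.1.4] -/
theorem weakPrincipalization_of (hG : Dominance.IdealsAreSumsOfDivisors) (hM : Dominance.MonomialPrincipalization)
    (hL : Dominance.LogResDiv) : Dominance.WeakPrincipalization := by
  intro p hp k _ _ Y g hg₁ hg₂ hg₃ hY hYreg I hI
  haveI := hg₁; haveI := hg₂; haveI := hg₃; haveI := hY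
  haveI : IsLocallyNoetherian Y := LocallyOfFiniteType.isLocallyNoetherian g
  haveI : CompactSpace Y := QuasiCompact.compactSpace_of_compactSpace g
  haveI : IsNoetherian Y := {}
  -- (1) `I` is a finite sum of effective Cartier ideals `D i`
  obtain ⟨n, D, hD, hDI⟩ := hG p hp k Y g hg₁ hg₂ hg₃ hY hYreg I hI
  set T : Set Y := ⋃ i, ((D i).support : Set Y) with hT
  have hξ : genericPoint Y ∉ T := by
    simp only [hT, Set.mem_iUnion, not_exists]
    exact fun i => genericPoint_not_mem_support (hD i)
  have hTc : IsClosed T := isClosed_iUnion_of_finite fun i => (D i).support.isClosed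
  -- (2) log resolution of the total divisor
  obtain ⟨Q₁, Y₁, π, hQ₁, hπ, hreg₁, hsnc⟩ := hL p hp k Y g hg₁ hg₂ hg₃ hY hYreg n D hD
  haveI := hπ.isProper
  have hQ₁ne : Q₁ ≠ ⊥ := by
    intro h
    apply hξ
    apply hQ₁
    rw [h, Scheme.IdealSheafData.support_bot]
    trivial
  haveI : IsIntegral Y₁ := hπ.isIntegral hQ₁ne
  -- the pulled-back divisors: effective Cartier, supported in the snc divisor `π⁻¹ T`
  let D₁ : Fin n → Y₁.IdealSheafData := fun i => (D i).comap π
  have hD₁ : ∀ i, IsEffectiveCartier (D₁ i) := fun i =>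
    IsEffectiveCartier.comap_of_isBlowup hπ (hD i)
  have hsup : (⨆ i, D₁ i) = I.comap π := by
    rw [← hDI]
    exact ((Scheme.IdealSheafData.map_gc π).l_iSup).symm
  have hU₁ : (⋃ i, ((D₁ i).support : Set Y₁)) = π ⁻¹' T := by
    simp only [D₁, hT, Scheme.IdealSheafData.support_comap, TopologicalSpace.Closeds.coe_preimage,
      Set.preimage_iUnion]
  -- `I𝒪_{Y₁} ≠ 0`: a point of `Y₁` over `U₀ ∖ T`, `U₀` the dense open over which `π` is an iso
  have hne : (⨆ i, D₁ i) ≠ ⊥ := by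
    rw [hsup]
    obtain ⟨U₀, hU₀d, -, hU₀iso⟩ := hπ.isBirational' hQ₁ne
    haveI := hU₀iso
    obtain ⟨y, hyT, hyU₀⟩ := hU₀d.inter_open_nonempty Tᶜ hTc.isOpen_compl ⟨_, hξ⟩
    obtain ⟨x, hx⟩ : ∃ x : Y₁, π x = y := by
      -- folklore (landed as `…EquisingularLiftNat.Sections.ND.exists_eq_of_isIso_morphismRestrict`; inlined to keep
      -- this file's import closure inside the Dominance cone)
      obtain ⟨v, hv⟩ := (ConcreteCategory.bijective_of_isIso (π ∣_ U₀).base).2 ⟨y, hyU₀⟩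
      exact ⟨(π ⁻¹ᵁ U₀).ι v, by
        have := morphismRestrict_base_coe π U₀ v; rw [hv] at this; exact this.symm⟩
    intro h
    have h1 : ((I.comap π).support : Set Y₁) = Set.univ := by
      rw [h, Scheme.IdealSheafData.support_bot]; rfl
    rw [Scheme.IdealSheafData.support_comap] at h1
    have hmem : x ∈ (TopologicalSpace.Closeds.preimage I.support π.continuous : Set Y₁) := by
      rw [h1]; trivial
    rw [TopologicalSpace.Closeds.coe_preimage, Set.mem_preimage, hx] at hmem
    -- `I = ⨆ D i`, so `Supp I ⊆ Supp (D i)` for every `i`; with `n = 0`, `I = ⊥`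
    rcases Nat.eq_zero_or_pos n with hn | hn
    · subst hn
      apply hI
      rw [← hDI]
      simp
    · have hle : D ⟨0, hn⟩ ≤ I := hDI ▸ le_iSup D ⟨0, hn⟩
      have hsub : (I.support : Set Y) ⊆ (D ⟨0, hn⟩).support :=
        Scheme.IdealSheafData.support_antitone hle
      exact hyT (Set.mem_iUnion.mpr ⟨⟨0, hn⟩, hsub hmem⟩)
  have hsnc₁ : IsStrictNormalCrossingsDivisor Y₁ (⋃ i, ((D₁ i).support : Set Y₁)) := by
    rw [hU₁]; exact hsnc
  -- (3) principalization of the monomial ideal `I𝒪_{Y₁} = ⨆ D₁ i` on `Y₁`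
  obtain ⟨Q₂, Y₂, π', hQ₂, hπ', hreg₂, hcart⟩ :=
    hM p hp k Y₁ (π ≫ g) inferInstance inferInstance inferInstance inferInstance hreg₁ n D₁ hD₁
      hne hsnc₁
  rw [hsup, ← Scheme.IdealSheafData.comap_comp] at hcart
  -- (4) Temkin: `π' ≫ π` is ONE blowing up of `Y` cosupported in `T`
  have hQ₂T : (Q₂.support : Set Y₁) ⊆ π ⁻¹' T := hU₁ ▸ hQ₂
  obtain ⟨Q, hQ, hQT⟩ := hπ.exists_isBlowup_comp_supported π Q₁ π' Q₂ T hQ₁ hπ' hQ₂T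
  refine ⟨Q, Y₂, π' ≫ π, ?_, hQ, hreg₂, hcart⟩
  intro h
  exact hξ (hQT (h ▸ Set.mem_univ _))

/-! ## Kernel 2: weak principalization ⇒ sandwiched resolution (proper form) -/

/-- **MR (proper form, stmt-24574) ⟸ weak principalization**: `U`-admissible domination
(Stacks 081T), Stacks 080A read backwards, Temkin 2008 Lemma 2.1.4, and transport of resolutions
along proper birational morphisms.  PROVED. [cite: StacksProject, Tag 081T] [cite: StacksProject,
Tag 080A] -/
theorem sandwichedResolveProper_of_weakPrincipalization (hW : Dominance.WeakPrincipalization) :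
    Dominance.SandwichedResolveProper := by
  intro p hp k _ _ Y g hg₁ hg₂ hg₃ hY hYreg Γ b hΓ hb hbir
  haveI := hg₁; haveI := hg₂; haveI := hg₃; haveI := hY; haveI := hΓ; haveI := hb
  haveI : IsLocallyNoetherian Y := LocallyOfFiniteType.isLocallyNoetherian g
  haveI : CompactSpace Y := QuasiCompact.compactSpace_of_compactSpace g
  haveI : IsNoetherian Y := {}
  haveI : IsLocallyNoetherian Γ := LocallyOfFiniteType.isLocallyNoetherian (b ≫ g)
  obtain ⟨U, hUd, hUd', hUiso⟩ := hbir
  haveI := hUiso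
  have hUc : IsCompact (U : Set Y) := NoetherianSpace.isCompact _
  -- `U`-admissible domination: `η : S' = Bl_I Y → Y`, `V(I) = Y ∖ U`, `r : S' → Γ`, `r ≫ b = η`
  obtain ⟨I, S', η, r, -, hsupp, hη, hrb, hr⟩ := exists_isBlowup_dominating b U hUc
  obtain ⟨y₀, hy₀⟩ := hUd.nonempty
  have hI : I ≠ ⊥ := by
    intro h
    have h1 : (I.support : Set Y) = Set.univ := by
      rw [h, Scheme.IdealSheafData.support_bot]; rfl
    have : y₀ ∈ (I.support : Set Y) := by rw [h1]; trivial
    rw [hsupp] at this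
    exact this hy₀
  haveI : IsIntegral S' := hη.isIntegral hI
  -- weak principalization of `I` on the regular variety `Y`
  obtain ⟨Q, Y₁, σ, hQ, hσ, hreg₁, hcart⟩ := hW p hp k Y g hg₁ hg₂ hg₃ hY hYreg I hI
  -- Stacks 080A backwards: `V' = Bl_{η⁻¹Q} S'` is regular
  obtain ⟨V', π₀, hπ₀, hreg'⟩ :=
    Summit.ResolutionOfSingularities.ResolutionOfSingularities.Theorems.exists_isBlowup_comap_isRegular
      hσ hreg₁ hcart hη
  -- Temkin: `π₀ ≫ η` is a blowing up of the Noetherian `Y`, hence proper; so is `π₀ ≫ r`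
  obtain ⟨Q', hQ', -⟩ := hη.exists_isBlowup_comp_supported η I π₀ (Q.comap η) Set.univ
    (Set.subset_univ _) hπ₀ (fun _ _ => Set.mem_univ _)
  haveI : IsProper (π₀ ≫ η) := hQ'.isProper
  have hcomp : (π₀ ≫ r) ≫ b = π₀ ≫ η := by rw [Category.assoc, hrb]
  haveI : IsProper ((π₀ ≫ r) ≫ b) := by rw [hcomp]; infer_instance
  haveI : IsProper (π₀ ≫ r) := IsProper.of_comp (π₀ ≫ r) b
  -- `r` is birational: `I𝒪_Γ ≠ 0` since `b⁻¹ U` is non-empty and misses `V(I𝒪_Γ) = b⁻¹ V(I)`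
  have hIb : I.comap b ≠ ⊥ := by
    intro h
    have h1 : ((I.comap b).support : Set Γ) = Set.univ := by
      rw [h, Scheme.IdealSheafData.support_bot]; rfl
    rw [Scheme.IdealSheafData.support_comap] at h1
    obtain ⟨x, hx⟩ := hUd'.nonempty
    have hmem : x ∈ (TopologicalSpace.Closeds.preimage I.support b.continuous : Set Γ) := by
      rw [h1]; trivial
    rw [TopologicalSpace.Closeds.coe_preimage, Set.mem_preimage, hsupp] at hmem
    exact hmem hx
  have hrbir : IsBirational r := hr.isBirational' hIb
  -- `π₀` is birational: `η⁻¹Q ≠ 0` since a point of `S'` lies over `U₂ ∖ V(Q)`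
  have hQη : Q.comap η ≠ ⊥ := by
    obtain ⟨U₂, hU₂d, -, hU₂iso⟩ := hη.isBirational' hI
    haveI := hU₂iso
    obtain ⟨y, hyQ, hyU₂⟩ :=
      hU₂d.inter_open_nonempty (Q.support : Set Y)ᶜ Q.support.isClosed.isOpen_compl
        (Set.nonempty_compl.mpr hQ)
    obtain ⟨x, hx⟩ : ∃ x : S', η x = y := by
      obtain ⟨v, hv⟩ := (ConcreteCategory.bijective_of_isIso (η ∣_ U₂).base).2 ⟨y, hyU₂⟩
      exact ⟨(η ⁻¹ᵁ U₂).ι v, by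
        have := morphismRestrict_base_coe η U₂ v; rw [hv] at this; exact this.symm⟩
    intro h
    have h1 : ((Q.comap η).support : Set S') = Set.univ := by
      rw [h, Scheme.IdealSheafData.support_bot]; rfl
    rw [Scheme.IdealSheafData.support_comap] at h1
    have hmem : x ∈ (TopologicalSpace.Closeds.preimage Q.support η.continuous : Set S') := by
      rw [h1]; trivial
    rw [TopologicalSpace.Closeds.coe_preimage, Set.mem_preimage, hx] at hmem
    exact hyQ hmem
  have hπ₀bir : IsBirational π₀ := hπ₀.isBirational' hQη
  exact ComponentGluing.Scheme.HasResolution.of_isBirational (π₀ ≫ r)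
    (ComponentGluing.IsBirational.comp hπ₀bir hrbir) hreg'.hasResolution

/-- **MR (proper form, stmt-24574) ⟸ the divisor cut.** PROVED. -/
theorem sandwichedResolveProper_of (hG : Dominance.IdealsAreSumsOfDivisors) (hM : Dominance.MonomialPrincipalization)
    (hL : Dominance.LogResDiv) : Dominance.SandwichedResolveProper :=
  sandwichedResolveProper_of_weakPrincipalization (weakPrincipalization_of hG hM hL)


end Summit.ResolutionOfSingularities.ResolutionOfSingularities.Theorems.DominanceDivisorCutPrincipalization

end
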